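import Mathlib
import Literature.AlgebraicGeometry.Resolution.CobordantGame
import Literature.AlgebraicGeometry.Resolution.CobordantChartCoefficients
import Literature.AlgebraicGeometry.Resolution.CobordantTupleGame
import Literature.AlgebraicGeometry.Resolution.FormalCoordinateChange
import Summits.ResolutionOfSingularities.ResolutionOfSingularities.Theorems.WeightedInvariantLocalWeightedDropMonicPointBlowup
import Summits.ResolutionOfSingularities.ResolutionOfSingularities.Theorems.WeightedInvariantLocalWeightedDropWildMonicWideExit

/-!
# `WeightedInvariant.LocalWeightedDrop`, line `hasse-ridge-face-selection`: the DESCENT LIFT for GENERAL MONIC SURFACE FORMS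
# `y^d + Σ_{j<d} A_j(x₁,x₂) y^j` — S3ρ `stub_wildMonicSurfaceReductionWon` follows from ANY state-carrying measure with the step
# property, given the terminal classes

Crux item stmt-ResolutionOfSingularities-8899 `LocalWeightedDrop` (route `ResolutionOfSingularities/WeightedInvariant`), engine of
the door `HypersurfaceCentreConstruction` stmt-ResolutionOfSingularities-19897.  [OURS · L1 W4.3, chain w43, res-type-083 (extra
seat S3ρ, CHAIN v4.3 D12): §C–§D of `L/res-type-083/S3RHO-DESIGN.md` — the tuple version of stub-1's
`WildPurePower.purePower_won_of_descent` / `wildPurelyInseparableReductionWon_of_descent`.  Not a statement of any manuscript;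
the MATHEMATICS to be supplied through the datum is the general-multiplicity surface resolution game (Perlega 2017/2020,
arXiv:2011.14443, Ch. 5/7/9; CJS LNM 2270 Part II).]

`monic_won_of_descent` (`k` algebraically closed of characteristic `p`, `d ≥ 1`).  DATA: any type of STATES with coefficient tuples
`germ s ∈ k[[x₁,x₂]]^d`, an ordinal MEASURE `μ`, and a caller-supplied EXIT PREDICATE `T` on positions with its winning proof.
STEP PROPERTY demanded, for every state whose tuple is a position (`ord A_j > d - j`): after a free PLANE CHANGE `θ` and a free
RE-CENTRING `y ↦ y + φ` (new position `A₁ = shift d (A ∘ θ) φ`; free by `won_monic_substX_iff`, `won_monic_recentre_iff`),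
EITHER `T A₁`, OR for every exceptional point of the POINT BLOW-UP (`won_monic_of_pointBlowup`) whose successor slice is singular of
order `d` with a WIDE apex, every LINEAR re-centring that makes it a position is the tuple of a state of SMALLER measure.
CONCLUSION: every state's monic form is won — the remaining successors are EXITS discharged here: order `< d` (the hypothesis on
smaller orders), order `d` and not wide (`WildPurePower.won_of_order_eq_of_not_wide`: apex-free or axis), wide (re-centred by
`WildMonic.exists_linShift_isPos_of_wide`).  `wildMonicSurfaceReductionWon_of_descent`: S3ρ VERBATIM from a TERMINAL predicate
with its winning theorem (S3ρT) and a datum (S3ρD) relative to the exits «terminal» and «pure `p^e`-th power form» (the latter is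
S3ρ's purely-inseparable hypothesis).  What remains for S3ρ is therefore exactly S3ρT (the terminal classes) and the MEASURE.
-/

set_option linter.dupNamespace false -- mandated namespace of this single-conjunct summit

namespace Summit.ResolutionOfSingularities.ResolutionOfSingularities.Theorems

open Literature.AlgebraicGeometry.Resolution
open Literature.AlgebraicGeometry.Resolution.CobordantGame

namespace WildMonic

open MvPowerSeries

variable {k : Type} [Field k] {m : ℕ}

/-! ### The descent lift -/

/-- THE DESCENT LIFT FOR GENERAL MONIC SURFACE FORMS `y^d + Σ_{j<d} A_j(x₁,x₂) y^j` (`d ≥ 1`, `k` algebraically closed of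
characteristic `p`).  DATA: a type of STATES with coefficient tuples `germ s` and an ordinal MEASURE `μ`, and a caller-supplied
EXIT PREDICATE `T` on positions with its winning proof `hT` (terminal classes, hand-offs).  STEP PROPERTY demanded, for every state
whose tuple is a position (`ord A_j > d - j`): after a free PLANE CHANGE `θ` and a free RE-CENTRING `y ↦ y + φ(x)` (new position
`A₁ = shift d (A ∘ θ) φ`), EITHER `T A₁`, OR for every exceptional point of the POINT BLOW-UP (live slot `i₀`, chart-divided
coefficients `Bv`), whenever the successor slice `y^d + Σ_j (s Bv_j)| y^j` is singular of order `d` with a WIDE apex, every LINEAR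
re-centring `y ↦ y - Σ μ'_i x_i` that makes it a position is the tuple of a state of SMALLER measure.  CONCLUSION: every state's
monic form is won — the other successors are exits discharged here once and for all: order `< d` (`hord`), order `d` with a cone
that is not wide (`WildPurePower.won_of_order_eq_of_not_wide`: apex-free or axis), and the wide case re-centres linearly to a
position (`exists_linShift_isPos_of_wide`).  [OURS · L1 W4.3; tuple version of `WildPurePower.purePower_won_of_descent`.] -/
theorem monic_won_of_descent (p : ℕ) (hp : p.Prime) (k : Type) [Field k] [CharP k p] [IsAlgClosed k] {d : ℕ} (hd : 0 < d)
    (hord : ∀ g : MvPowerSeries (Fin 3) k, CobordantGame.IsSingular k g → g.order < d → CobordantGame.Won k 3 g)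
    (haxis : ∀ g : MvPowerSeries (Fin 3) k, CobordantGame.IsSingular k g → g.order = d →
      (∃ c : Fin 3 → k, c ≠ 0 ∧ ∀ v : Fin 3 → k,
        CobordantChart.initEval (fun _ : Fin 3 => 1) (v + c) d g = CobordantChart.initEval (fun _ : Fin 3 => 1) v d g) →
      (∀ c₁ c₂ : Fin 3 → k,
        (∀ v : Fin 3 → k, CobordantChart.initEval (fun _ : Fin 3 => 1) (v + c₁) d g =
          CobordantChart.initEval (fun _ : Fin 3 => 1) v d g) →
        (∀ v : Fin 3 → k, CobordantChart.initEval (fun _ : Fin 3 => 1) (v + c₂) d g =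
          CobordantChart.initEval (fun _ : Fin 3 => 1) v d g) →
        ∃ α β : k, (α ≠ 0 ∨ β ≠ 0) ∧ α • c₁ + β • c₂ = 0) →
      CobordantGame.Won k 3 g)
    (T : (Fin d → MvPowerSeries (Fin 2) k) → Prop)
    (hT : ∀ A : Fin d → MvPowerSeries (Fin 2) k, (∀ j : Fin d, ((d - (j : ℕ) : ℕ) : ℕ∞) < (A j).order) → T A →
      CobordantGame.Won k (2 + 1) ((X (Fin.last 2) : MvPowerSeries (Fin (2 + 1)) k) ^ d +
        ∑ j : Fin d, rename (Fin.succAboveEmb (Fin.last 2)) (A j) * X (Fin.last 2) ^ (j : ℕ)))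
    {S : Type*} (germ : S → Fin d → MvPowerSeries (Fin 2) k) (μ : S → Ordinal.{0})
    (hstep : ∀ s : S, (∀ j : Fin d, ((d - (j : ℕ) : ℕ) : ℕ∞) < (germ s j).order) →
      ∃ (θ : Fin 2 → MvPowerSeries (Fin 2) k) (φ : MvPowerSeries (Fin 2) k),
        (∀ i, constantCoeff (θ i) = 0) ∧ IsUnit (FormalCoordChange.linMat θ).det ∧ constantCoeff φ = 0 ∧
        (∀ j : Fin d, ((d - (j : ℕ) : ℕ) : ℕ∞) < (shift d (fun j => subst θ (germ s j)) φ j).order) ∧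
        (T (shift d (fun j => subst θ (germ s j)) φ) ∨
          ∀ (c : Fin 2 → k) (i₀ : Fin 2), c i₀ ≠ 0 → ∀ Bv : Fin d → MvPowerSeries (Fin (2 + 1)) k,
            (∀ j : Fin d, subst (CobordantChart.chart (fun _ : Fin 2 => 1) c) (shift d (fun j => subst θ (germ s j)) φ j) =
              X 0 ^ (d - (j : ℕ) + 1) * Bv j) →
            CobordantGame.IsSingular k ((X (Fin.last 2) : MvPowerSeries (Fin (2 + 1)) k) ^ d +
              ∑ j : Fin d, rename (Fin.succAboveEmb (Fin.last 2)) (TupleGame.slice i₀ (X 0 * Bv j)) *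
                X (Fin.last 2) ^ (j : ℕ)) →
            ((X (Fin.last 2) : MvPowerSeries (Fin (2 + 1)) k) ^ d +
              ∑ j : Fin d, rename (Fin.succAboveEmb (Fin.last 2)) (TupleGame.slice i₀ (X 0 * Bv j)) *
                X (Fin.last 2) ^ (j : ℕ)).order = d →
            (∃ c₁ c₂ : Fin 3 → k, (∀ α β : k, α • c₁ + β • c₂ = 0 → α = 0 ∧ β = 0) ∧
              (∀ v : Fin 3 → k, CobordantChart.initEval (fun _ : Fin 3 => 1) (v + c₁) d
                ((X (Fin.last 2) : MvPowerSeries (Fin (2 + 1)) k) ^ d +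
                  ∑ j : Fin d, rename (Fin.succAboveEmb (Fin.last 2)) (TupleGame.slice i₀ (X 0 * Bv j)) *
                    X (Fin.last 2) ^ (j : ℕ)) =
                CobordantChart.initEval (fun _ : Fin 3 => 1) v d
                ((X (Fin.last 2) : MvPowerSeries (Fin (2 + 1)) k) ^ d +
                  ∑ j : Fin d, rename (Fin.succAboveEmb (Fin.last 2)) (TupleGame.slice i₀ (X 0 * Bv j)) *
                    X (Fin.last 2) ^ (j : ℕ))) ∧
              (∀ v : Fin 3 → k, CobordantChart.initEval (fun _ : Fin 3 => 1) (v + c₂) d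
                ((X (Fin.last 2) : MvPowerSeries (Fin (2 + 1)) k) ^ d +
                  ∑ j : Fin d, rename (Fin.succAboveEmb (Fin.last 2)) (TupleGame.slice i₀ (X 0 * Bv j)) *
                    X (Fin.last 2) ^ (j : ℕ)) =
                CobordantChart.initEval (fun _ : Fin 3 => 1) v d
                ((X (Fin.last 2) : MvPowerSeries (Fin (2 + 1)) k) ^ d +
                  ∑ j : Fin d, rename (Fin.succAboveEmb (Fin.last 2)) (TupleGame.slice i₀ (X 0 * Bv j)) *
                    X (Fin.last 2) ^ (j : ℕ)))) →
            ∀ μ' : Fin 2 → k,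
              (∀ j : Fin d, ((d - (j : ℕ) : ℕ) : ℕ∞) <
                (shift d (fun j => TupleGame.slice i₀ (X 0 * Bv j)) (-(∑ i : Fin 2, C (μ' i) * X i)) j).order) →
              ∃ s' : S, germ s' = shift d (fun j => TupleGame.slice i₀ (X 0 * Bv j)) (-(∑ i : Fin 2, C (μ' i) * X i)) ∧
                μ s' < μ s)) :
    ∀ s : S, (∀ j : Fin d, ((d - (j : ℕ) : ℕ) : ℕ∞) < (germ s j).order) →
      CobordantGame.Won k (2 + 1) ((X (Fin.last 2) : MvPowerSeries (Fin (2 + 1)) k) ^ d +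
        ∑ j : Fin d, rename (Fin.succAboveEmb (Fin.last 2)) (germ s j) * X (Fin.last 2) ^ (j : ℕ)) := by
  classical
  suffices key : ∀ (α : Ordinal.{0}) (s : S), μ s = α → (∀ j : Fin d, ((d - (j : ℕ) : ℕ) : ℕ∞) < (germ s j).order) →
      Won k (2 + 1) ((X (Fin.last 2) : MvPowerSeries (Fin (2 + 1)) k) ^ d +
        ∑ j : Fin d, rename (Fin.succAboveEmb (Fin.last 2)) (germ s j) * X (Fin.last 2) ^ (j : ℕ)) from
    fun s hs => key _ s rfl hs
  intro α
  induction α using WellFoundedLT.induction with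
  | ind α ih =>
  intro s hα hs
  obtain ⟨θ, φ, hθ0, hθdet, hφ0, hA₁, hbr⟩ := hstep s hs
  -- the free moves: plane change, then re-centring
  rw [← won_monic_substX_iff θ hθ0 hθdet, ← won_monic_recentre_iff φ hφ0]
  set A₁ : Fin d → MvPowerSeries (Fin 2) k := shift d (fun j => subst θ (germ s j)) φ with hA₁def
  rcases hbr with hTA | hpt
  · exact hT A₁ hA₁ hTA
  · -- the point blow-up; every singular successor is an exit or re-centres to a smaller state
    refine won_monic_of_pointBlowup p hp k 2 d hd A₁ hA₁ fun c i₀ hci₀ Bv hBv hSs => ?_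
    set Tt : Fin d → MvPowerSeries (Fin 2) k := fun j => TupleGame.slice i₀ (X 0 * Bv j) with hTt
    set Sg : MvPowerSeries (Fin (2 + 1)) k := (X (Fin.last 2) : MvPowerSeries (Fin (2 + 1)) k) ^ d +
      ∑ j : Fin d, rename (Fin.succAboveEmb (Fin.last 2)) (Tt j) * X (Fin.last 2) ^ (j : ℕ) with hSg
    by_cases hlt : Sg.order < (d : ℕ)
    · exact hord _ hSs hlt
    rw [not_lt] at hlt
    have hSo : Sg.order = d := le_antisymm (order_monicForm_le Tt) hlt
    by_cases hwide : ∃ c₁ c₂ : Fin 3 → k, (∀ α β : k, α • c₁ + β • c₂ = 0 → α = 0 ∧ β = 0) ∧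
        (∀ v : Fin 3 → k, CobordantChart.initEval (fun _ : Fin 3 => 1) (v + c₁) d Sg =
          CobordantChart.initEval (fun _ : Fin 3 => 1) v d Sg) ∧
        (∀ v : Fin 3 → k, CobordantChart.initEval (fun _ : Fin 3 => 1) (v + c₂) d Sg =
          CobordantChart.initEval (fun _ : Fin 3 => 1) v d Sg)
    · -- wide apex: re-centre linearly to a position, which is a smaller state
      obtain ⟨c₁, c₂, hind, h₁, h₂⟩ := hwide
      obtain ⟨μ', hpos⟩ := exists_linShift_isPos_of_wide k hd Tt hlt c₁ c₂ hind h₁ h₂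
      obtain ⟨s', hs', hμ⟩ := hpt c i₀ hci₀ Bv hBv hSs hSo ⟨c₁, c₂, hind, h₁, h₂⟩ μ' hpos
      have hφ'0 : constantCoeff (-(∑ i : Fin 2, C (μ' i) * X i) : MvPowerSeries (Fin 2) k) = 0 := by
        rw [map_neg, map_sum, Finset.sum_eq_zero, neg_zero]
        intro i _
        rw [map_mul, constantCoeff_X, mul_zero]
      rw [hSg, ← won_monic_recentre_iff (-(∑ i : Fin 2, C (μ' i) * X i)) hφ'0 Tt, ← hs']
      exact ih (μ s') (hα ▸ hμ) s' rfl (by rw [hs']; exact hpos)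
    · -- not wide: apex-free or axis
      exact WildPurePower.won_of_order_eq_of_not_wide p hp k hord haxis _ hSs hSo hwide


/-! ### S3ρ from the pieces: terminal classes + descent datum -/

/-- The monic form of a tuple supported at `j = 0` only is the pure form `y^d + A₀`. -/
theorem monicForm_eq_purePower {d : ℕ} (hd : 0 < d) (A : Fin d → MvPowerSeries (Fin m) k)
    (hA : ∀ j : Fin d, (j : ℕ) ≠ 0 → A j = 0) :
    X (Fin.last m) ^ d + ∑ j : Fin d, rename (Fin.succAboveEmb (Fin.last m)) (A j) * X (Fin.last m) ^ (j : ℕ) =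
      X (Fin.last m) ^ d + rename (Fin.succAboveEmb (Fin.last m)) (A ⟨0, hd⟩) := by
  congr 1
  rw [Finset.sum_eq_single ⟨0, hd⟩]
  · simp only [pow_zero, mul_one]
  · intro j _ hj
    rw [hA j (fun h => hj (Fin.ext h)), map_zero, zero_mul]
  · intro h; exact absurd (Finset.mem_univ _) h

/-- S3ρ `stub_wildMonicSurfaceReductionWon` VERBATIM FROM THE PIECES (see `monic_won_of_descent`): a TERMINAL PREDICATE `Term`
with its winning theorem (S3ρT: the terminal classes are won under S3ρ's side hypotheses) and a DESCENT DATUM (S3ρD) covering every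
position, with the step property relative to the exits «`Term`» and «pure `p^e`-th power form» (the latter handed to the purely
inseparable hypothesis of S3ρ).  This is the sorry-free composition of the line under the stub. -/
theorem wildMonicSurfaceReductionWon_of_descent
    (Term : ∀ (k : Type) [Field k] (d : ℕ), (Fin d → MvPowerSeries (Fin 2) k) → Prop)
    (hterm : ∀ (p : ℕ), p.Prime → ∀ (k : Type) [Field k] [CharP k p] [IsAlgClosed k],
      ∀ (d : ℕ), p ∣ d → 2 < d →
      (∀ g : MvPowerSeries (Fin 3) k, CobordantGame.IsSingular k g → g.order < d →
        CobordantGame.Won k 3 g) →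
      (∀ g : MvPowerSeries (Fin 3) k, CobordantGame.IsSingular k g → g.order = d →
        (∃ c : Fin 3 → k, c ≠ 0 ∧ ∀ v : Fin 3 → k,
          CobordantChart.initEval (fun _ : Fin 3 => 1) (v + c) d g =
            CobordantChart.initEval (fun _ : Fin 3 => 1) v d g) →
        (∀ c₁ c₂ : Fin 3 → k,
          (∀ v : Fin 3 → k, CobordantChart.initEval (fun _ : Fin 3 => 1) (v + c₁) d g =
            CobordantChart.initEval (fun _ : Fin 3 => 1) v d g) →
          (∀ v : Fin 3 → k, CobordantChart.initEval (fun _ : Fin 3 => 1) (v + c₂) d g =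
            CobordantChart.initEval (fun _ : Fin 3 => 1) v d g) →
          ∃ α β : k, (α ≠ 0 ∨ β ≠ 0) ∧ α • c₁ + β • c₂ = 0) →
        CobordantGame.Won k 3 g) →
      ∀ A : Fin d → MvPowerSeries (Fin 2) k, (∀ j : Fin d, ((d - (j : ℕ) : ℕ) : ℕ∞) < (A j).order) → Term k d A →
        CobordantGame.Won k 3 (MvPowerSeries.X (Fin.last 2) ^ d +
          ∑ j : Fin d, MvPowerSeries.rename (Fin.succAboveEmb (Fin.last 2)) (A j) * MvPowerSeries.X (Fin.last 2) ^ (j : ℕ)))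
    (hdesc : ∀ (p : ℕ), p.Prime → ∀ (k : Type) [Field k] [CharP k p] [IsAlgClosed k],
      (∀ m : ℕ, m < 3 → ∀ g : MvPowerSeries (Fin m) k,
        CobordantGame.IsSingular k g → CobordantGame.Won k m g) →
      ∀ (d : ℕ), p ∣ d → 2 < d →
      (∀ g : MvPowerSeries (Fin 3) k, CobordantGame.IsSingular k g → g.order < d →
        CobordantGame.Won k 3 g) →
      (∀ g : MvPowerSeries (Fin 3) k, CobordantGame.IsSingular k g → g.order = d →
        (∃ c : Fin 3 → k, c ≠ 0 ∧ ∀ v : Fin 3 → k,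
          CobordantChart.initEval (fun _ : Fin 3 => 1) (v + c) d g =
            CobordantChart.initEval (fun _ : Fin 3 => 1) v d g) →
        (∀ c₁ c₂ : Fin 3 → k,
          (∀ v : Fin 3 → k, CobordantChart.initEval (fun _ : Fin 3 => 1) (v + c₁) d g =
            CobordantChart.initEval (fun _ : Fin 3 => 1) v d g) →
          (∀ v : Fin 3 → k, CobordantChart.initEval (fun _ : Fin 3 => 1) (v + c₂) d g =
            CobordantChart.initEval (fun _ : Fin 3 => 1) v d g) →
          ∃ α β : k, (α ≠ 0 ∨ β ≠ 0) ∧ α • c₁ + β • c₂ = 0) →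
        CobordantGame.Won k 3 g) →
      ∃ (S : Type) (germ : S → Fin d → MvPowerSeries (Fin 2) k) (μ : S → Ordinal.{0}),
        (∀ A : Fin d → MvPowerSeries (Fin 2) k, (∀ j : Fin d, ((d - (j : ℕ) : ℕ) : ℕ∞) < (A j).order) →
          ∃ s, germ s = A) ∧
        (∀ s : S, (∀ j : Fin d, ((d - (j : ℕ) : ℕ) : ℕ∞) < (germ s j).order) →
          ∃ (θ : Fin 2 → MvPowerSeries (Fin 2) k) (φ : MvPowerSeries (Fin 2) k),
            (∀ i, constantCoeff (θ i) = 0) ∧ IsUnit (FormalCoordChange.linMat θ).det ∧ constantCoeff φ = 0 ∧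
            (∀ j : Fin d, ((d - (j : ℕ) : ℕ) : ℕ∞) < (shift d (fun j => subst θ (germ s j)) φ j).order) ∧
            ((Term k d (shift d (fun j => subst θ (germ s j)) φ) ∨
              ((∃ e : ℕ, d = p ^ e) ∧ ∀ j : Fin d, (j : ℕ) ≠ 0 → shift d (fun j => subst θ (germ s j)) φ j = 0)) ∨
              ∀ (c : Fin 2 → k) (i₀ : Fin 2), c i₀ ≠ 0 → ∀ Bv : Fin d → MvPowerSeries (Fin (2 + 1)) k,
                (∀ j : Fin d, subst (CobordantChart.chart (fun _ : Fin 2 => 1) c)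
                  (shift d (fun j => subst θ (germ s j)) φ j) = X 0 ^ (d - (j : ℕ) + 1) * Bv j) →
                CobordantGame.IsSingular k ((X (Fin.last 2) : MvPowerSeries (Fin (2 + 1)) k) ^ d +
                  ∑ j : Fin d, rename (Fin.succAboveEmb (Fin.last 2)) (TupleGame.slice i₀ (X 0 * Bv j)) *
                    X (Fin.last 2) ^ (j : ℕ)) →
                ((X (Fin.last 2) : MvPowerSeries (Fin (2 + 1)) k) ^ d +
                  ∑ j : Fin d, rename (Fin.succAboveEmb (Fin.last 2)) (TupleGame.slice i₀ (X 0 * Bv j)) *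
                    X (Fin.last 2) ^ (j : ℕ)).order = d →
                (∃ c₁ c₂ : Fin 3 → k, (∀ α β : k, α • c₁ + β • c₂ = 0 → α = 0 ∧ β = 0) ∧
                  (∀ v : Fin 3 → k, CobordantChart.initEval (fun _ : Fin 3 => 1) (v + c₁) d
                    ((X (Fin.last 2) : MvPowerSeries (Fin (2 + 1)) k) ^ d +
                      ∑ j : Fin d, rename (Fin.succAboveEmb (Fin.last 2)) (TupleGame.slice i₀ (X 0 * Bv j)) *
                        X (Fin.last 2) ^ (j : ℕ)) =
                    CobordantChart.initEval (fun _ : Fin 3 => 1) v d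
                    ((X (Fin.last 2) : MvPowerSeries (Fin (2 + 1)) k) ^ d +
                      ∑ j : Fin d, rename (Fin.succAboveEmb (Fin.last 2)) (TupleGame.slice i₀ (X 0 * Bv j)) *
                        X (Fin.last 2) ^ (j : ℕ))) ∧
                  (∀ v : Fin 3 → k, CobordantChart.initEval (fun _ : Fin 3 => 1) (v + c₂) d
                    ((X (Fin.last 2) : MvPowerSeries (Fin (2 + 1)) k) ^ d +
                      ∑ j : Fin d, rename (Fin.succAboveEmb (Fin.last 2)) (TupleGame.slice i₀ (X 0 * Bv j)) *
                        X (Fin.last 2) ^ (j : ℕ)) =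
                    CobordantChart.initEval (fun _ : Fin 3 => 1) v d
                    ((X (Fin.last 2) : MvPowerSeries (Fin (2 + 1)) k) ^ d +
                      ∑ j : Fin d, rename (Fin.succAboveEmb (Fin.last 2)) (TupleGame.slice i₀ (X 0 * Bv j)) *
                        X (Fin.last 2) ^ (j : ℕ)))) →
                ∀ μ' : Fin 2 → k,
                  (∀ j : Fin d, ((d - (j : ℕ) : ℕ) : ℕ∞) <
                    (shift d (fun j => TupleGame.slice i₀ (X 0 * Bv j)) (-(∑ i : Fin 2, C (μ' i) * X i)) j).order) →
                  ∃ s' : S, germ s' = shift d (fun j => TupleGame.slice i₀ (X 0 * Bv j))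
                      (-(∑ i : Fin 2, C (μ' i) * X i)) ∧ μ s' < μ s))) :
    ∀ (p : ℕ), p.Prime → ∀ (k : Type) [Field k] [CharP k p] [IsAlgClosed k],
      (∀ m : ℕ, m < 3 → ∀ g : MvPowerSeries (Fin m) k,
        CobordantGame.IsSingular k g → CobordantGame.Won k m g) →
      ∀ (d : ℕ), p ∣ d → 2 < d →
      (∀ g : MvPowerSeries (Fin 3) k, CobordantGame.IsSingular k g → g.order < d →
        CobordantGame.Won k 3 g) →
      (∀ g : MvPowerSeries (Fin 3) k, CobordantGame.IsSingular k g → g.order = d →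
        (∃ c : Fin 3 → k, c ≠ 0 ∧ ∀ v : Fin 3 → k,
          CobordantChart.initEval (fun _ : Fin 3 => 1) (v + c) d g =
            CobordantChart.initEval (fun _ : Fin 3 => 1) v d g) →
        (∀ c₁ c₂ : Fin 3 → k,
          (∀ v : Fin 3 → k, CobordantChart.initEval (fun _ : Fin 3 => 1) (v + c₁) d g =
            CobordantChart.initEval (fun _ : Fin 3 => 1) v d g) →
          (∀ v : Fin 3 → k, CobordantChart.initEval (fun _ : Fin 3 => 1) (v + c₂) d g =
            CobordantChart.initEval (fun _ : Fin 3 => 1) v d g) →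
          ∃ α β : k, (α ≠ 0 ∨ β ≠ 0) ∧ α • c₁ + β • c₂ = 0) →
        CobordantGame.Won k 3 g) →
      ((∃ e : ℕ, d = p ^ e) → ∀ (A₀ : MvPowerSeries (Fin 2) k), (d : ℕ∞) < A₀.order →
        CobordantGame.Won k 3 (MvPowerSeries.X (Fin.last 2) ^ d +
          MvPowerSeries.rename (Fin.succAboveEmb (Fin.last 2)) A₀)) →
      ∀ A : Fin d → MvPowerSeries (Fin 2) k, (∀ j : Fin d, ((d - (j : ℕ) : ℕ) : ℕ∞) < (A j).order) →
        CobordantGame.Won k 3 (MvPowerSeries.X (Fin.last 2) ^ d +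
          ∑ j : Fin d, MvPowerSeries.rename (Fin.succAboveEmb (Fin.last 2)) (A j) * MvPowerSeries.X (Fin.last 2) ^ (j : ℕ)) := by
  intro p hp k _ _ _ hlow d hpd h2d hord haxis hpure A hA
  have hd : 0 < d := by omega
  obtain ⟨S, germ, μ, hcover, hstep⟩ := hdesc p hp k hlow d hpd h2d hord haxis
  obtain ⟨s, hs⟩ := hcover A hA
  rw [← hs]
  refine monic_won_of_descent p hp k hd hord haxis
    (fun A => Term k d A ∨ ((∃ e : ℕ, d = p ^ e) ∧ ∀ j : Fin d, (j : ℕ) ≠ 0 → A j = 0)) ?_ germ μ ?_ s (by rw [hs]; exact hA)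
  · -- the exits: terminal classes (S3ρT) and the pure `p^e`-th power forms (hypothesis of S3ρ)
    intro B hB hT
    rcases hT with hTB | ⟨hpe, hpureB⟩
    · exact hterm p hp k d hpd h2d hord haxis B hB hTB
    · rw [monicForm_eq_purePower hd B hpureB]
      have h0 := hB ⟨0, hd⟩
      rw [Nat.sub_zero] at h0
      exact hpure hpe (B ⟨0, hd⟩) h0
  · intro s' hs'
    obtain ⟨θ, φ, hθ0, hθdet, hφ0, hA₁, hbr⟩ := hstep s' hs'
    exact ⟨θ, φ, hθ0, hθdet, hφ0, hA₁, hbr⟩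

end WildMonic

end Summit.ResolutionOfSingularities.ResolutionOfSingularities.Theorems
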